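import Literature.Geometry.Lorentzian.MaxAtlasChart
import Literature.Geometry.Lorentzian.KillingFieldOnNaturality
import Literature.Geometry.Lorentzian.LeviCivitaProofs
import HarnessLib

/-!
# Local Killing fields read in a chart of the maximal atlas, and back

Companion of `MaxAtlasChart.lean` (a chart `ψ` of the maximal `C^∞` atlas of a manifold `X`
modelled on `𝓘(ℝ, E)` as a local isometry `Ψ = MaxAtlasChart.inv ψ : ψ.target → X` onto the
transported metric `MaxAtlasChart.metric g hψ = Ψ^* g` on the open submanifold `ψ.target ⊆ E`).
We transport vector fields and their Killing property in BOTH directions, in the form needed to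
apply a theorem about GLOBAL objects on the chart target (e.g. an extension theorem for Killing
fields on a simply connected analytic chart domain) to LOCAL data on `X`:

* `isKillingFieldOn_mpullback_inv`, `isKillingField_mpullback_inv` — **down**: a Killing field
  of `g` on an open `D ⊆ X` (resp. on `X`) pulls back along `Ψ` to a Killing field of `Ψ^* g` on
  `Ψ ⁻¹' D` (resp. on the whole target) (O'Neill 1983, Ch. 9, Prop. 9.25 with Ch. 3, Prop. 3.59;
  the tree's `IsKillingFieldOn.comap_mpullback`, `IsKillingField.comap_mpullback`);
* `exists_contMDiffOn_source_mpullback_inv_eq` — **up, the field**: every `C^∞` vector field `Y`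
  on the target is `Ψ^* L'` for a section `L'` of `TX` which is `C^∞` on `ψ.source` (namely
  `L' = ψ^* Ỹ`, `Ỹ` the representative of `Y` on `E`, Mathlib's `VectorField.mpullback`);
* `killingOn_source_of_mpullback_inv` — **up, the Killing equation**: if `Ψ^* L'` satisfies the
  Killing equation of `Ψ^* g` on the target and `L'` is `C^∞` on `ψ.source`, then `L'` satisfies
  the Killing equation of `g` on `ψ.source` (naturality `val_leviCivita_mpullback_add` and
  surjectivity of `dΨ`);
* `mlieBracket_inv_eq` — **up, brackets**: `[T, L'](Ψ p) = dΨ_p [Ψ^* T, Ψ^* L'](p)` (Mathlib's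
  `VectorField.mpullback_mlieBracket`);
* `apply_inv_eq_mfderiv_mpullback`, `isConnected_inv_preimage`, `isOpen_inv_preimage` —
  bookkeeping (`L' (Ψ p) = dΨ_p (Ψ^* L')(p)`; `Ψ ⁻¹' D` is connected when `ψ '' (ψ.source ∩ D)`
  is).

Everything is proved; no definitions, no named facts.

## References

* B. O'Neill, *Semi-Riemannian geometry with applications to relativity*, Academic Press 1983,
  Ch. 3, Prop. 3.59 and pp. 90–91 (local isometries preserve the connection); Ch. 9,
  Def. 9.22–Prop. 9.25 (Killing fields, `dΦ` carries Killing fields to Killing fields).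
  [ONeill1983]
-/

noncomputable section

open Bundle Set Function Filter TopologicalSpace Manifold VectorField
open scoped Manifold ContDiff Topology

namespace Literature.Geometry.Lorentzian

namespace MaxAtlasChart

variable {E : Type*} [NormedAddCommGroup E] [NormedSpace ℝ E]
  {X : Type*} [TopologicalSpace X] [ChartedSpace E X] {ψ : OpenPartialHomeomorph X E}

/-! ### Bookkeeping on the inverse chart -/

omit [NormedSpace ℝ E] [ChartedSpace E X] in
/-- `Ψ ⁻¹' D` is open for `D` open. [folklore] -/
theorem isOpen_inv_preimage {D : Set X} (hD : IsOpen D) : IsOpen (inv ψ ⁻¹' D) :=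
  hD.preimage (ψ.continuousOn_symm.comp_continuous continuous_subtype_val fun p ↦ p.2)

omit [NormedSpace ℝ E] [ChartedSpace E X] in
/-- The inclusion `ψ.target ⊆ E` maps `Ψ ⁻¹' D` onto `ψ '' (ψ.source ∩ D)`. [folklore] -/
theorem image_val_inv_preimage (D : Set X) :
    Subtype.val '' (inv ψ ⁻¹' D : Set (target ψ)) = ψ '' (ψ.source ∩ D) := by
  rw [ψ.image_source_inter_eq']
  ext z
  constructor
  · rintro ⟨p, hp, rfl⟩
    exact ⟨p.2, hp⟩
  · rintro ⟨hz, hzD⟩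
    exact ⟨⟨z, hz⟩, hzD, rfl⟩

omit [NormedSpace ℝ E] [ChartedSpace E X] in
/-- **`Ψ ⁻¹' D` is connected as soon as its image `ψ '' (ψ.source ∩ D)` in the chart is** (the
inclusion of the open submanifold `ψ.target` into `E` is an embedding). [folklore] -/
theorem isConnected_inv_preimage {D : Set X} (h : IsConnected (ψ '' (ψ.source ∩ D))) :
    IsConnected (inv ψ ⁻¹' D) := by
  rw [← image_val_inv_preimage D] at h
  refine ⟨?_, Topology.IsInducing.subtypeVal.isPreconnected_image.1 h.isPreconnected⟩
  obtain ⟨_, p, hp, rfl⟩ := h.nonempty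
  exact ⟨p, hp⟩

omit [NormedSpace ℝ E] [ChartedSpace E X] in
/-- Every point of `ψ.source` is `Ψ p` for the point `p = ψ x` of the target. [folklore] -/
theorem exists_inv_eq {x : X} (hx : x ∈ ψ.source) : ∃ p : target ψ, inv ψ p = x :=
  ⟨⟨ψ x, ψ.map_source hx⟩, ψ.left_inv hx⟩

variable [FiniteDimensional ℝ E]

/-- **Values of a field from its pullback to the chart**: `L' (Ψ p) = dΨ_p ((Ψ^* L') p)`
(`dΨ_p` is invertible). [folklore] -/
theorem apply_inv_eq_mfderiv_mpullback (hψ : ψ ∈ IsManifold.maximalAtlas 𝓘(ℝ, E) ∞ X)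
    (L' : Π x : X, TangentSpace 𝓘(ℝ, E) x) (p : target ψ) :
    L' (inv ψ p) =
      mfderiv 𝓘(ℝ, E) 𝓘(ℝ, E) (inv ψ) p (mpullback 𝓘(ℝ, E) 𝓘(ℝ, E) (inv ψ) L' p) :=
  (PseudoRiemannianMetric.mfderiv_mpullback_apply (injective_mfderiv_inv hψ) rfl L' p).symm

variable [IsManifold 𝓘(ℝ, E) ∞ X]

/-! ### Up: a smooth field on the chart target is the pullback of a field smooth on the source -/

omit [FiniteDimensional ℝ E] in
/-- **A `C^∞` vector field on the chart target comes from a field `C^∞` on the chart source.**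
For `Y` a `C^∞` section of the tangent bundle of the open submanifold `ψ.target ⊆ E` there is a
section `L'` of `TX`, `C^∞` on `ψ.source`, with `Ψ^* L' = Y` on the target: take `L' = ψ^* Ỹ`,
the pullback along the chart `ψ` (Mathlib's `VectorField.mpullback`,
`ContMDiffWithinAt.mpullback_vectorField_preimage`) of the representative `Ỹ : E → E` of `Y`
(extended by `0`); then `(Ψ^* L')(p) = (dΨ_p)⁻¹ (dψ_{Ψ p})⁻¹ Ỹ(p) = Y p` because
`dψ_{Ψ p} ∘ dΨ_p = id`. O'Neill 1983, Ch. 1, pp. 13–15 (vector fields and their coordinate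
expressions). [folklore] -/
theorem exists_contMDiffOn_source_mpullback_inv_eq [CompleteSpace E]
    (hψ : ψ ∈ IsManifold.maximalAtlas 𝓘(ℝ, E) ∞ X)
    (Y : Π p : target ψ, TangentSpace 𝓘(ℝ, E) p)
    (hY : ContMDiff 𝓘(ℝ, E) (𝓘(ℝ, E).prod 𝓘(ℝ, E)) ∞
      (fun p ↦ (TotalSpace.mk' E p (Y p) : TangentBundle 𝓘(ℝ, E) (target ψ)))) :
    ∃ L' : Π x : X, TangentSpace 𝓘(ℝ, E) x,
      ContMDiffOn 𝓘(ℝ, E) (𝓘(ℝ, E).prod 𝓘(ℝ, E)) ∞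
          (fun x ↦ (TotalSpace.mk' E x (L' x) : TangentBundle 𝓘(ℝ, E) X)) ψ.source ∧
        ∀ p : target ψ, mpullback 𝓘(ℝ, E) 𝓘(ℝ, E) (inv ψ) L' p = Y p := by
  classical
  -- the representative of `Y` on `E`, as a vector field on the model space
  set Yt : Π z : E, TangentSpace 𝓘(ℝ, E) z :=
    fun z ↦ if h : z ∈ ψ.target then (Y ⟨z, h⟩ : E) else 0 with hYt_def
  have hYt : ∀ p : target ψ, Y p = Yt p := fun p ↦ by
    have hp : (p : E) ∈ ψ.target := p.2
    simp only [hYt_def, dif_pos hp]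
  have hd := mdifferentiable_chart hψ
  refine ⟨mpullback 𝓘(ℝ, E) 𝓘(ℝ, E) ψ Yt, fun x hx ↦ ?_, fun p ↦ ?_⟩
  · -- smoothness of `ψ^* Ỹ` on the source
    set p : target ψ := ⟨ψ x, ψ.map_source hx⟩ with hp
    have h1 : ContMDiffAt 𝓘(ℝ, E) (𝓘(ℝ, E).prod 𝓘(ℝ, E)) ∞
        (fun p ↦ (TotalSpace.mk' E p (Y p) : TangentBundle 𝓘(ℝ, E) (target ψ))) p := hY p
    rw [OpensChart.contMDiffAt_section_iff, OpensChart.contMDiffAt_iff p _ Yt hYt] at h1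
    have hYs : ContMDiffWithinAt 𝓘(ℝ, E) (𝓘(ℝ, E).prod 𝓘(ℝ, E)) ∞
        (fun z ↦ (TotalSpace.mk' E z (Yt z) : TangentBundle 𝓘(ℝ, E) E)) ψ.target (ψ x) :=
      contMDiffWithinAt_vectorSpace_iff_contDiffWithinAt.2 h1.contDiffWithinAt
    have hψx : ContMDiffAt 𝓘(ℝ, E) 𝓘(ℝ, E) (∞ + 1) ψ x := by
      rw [show ((∞ : ℕ∞ω) + 1) = ∞ from rfl]
      exact (contMDiffOn_of_mem_maximalAtlas hψ).contMDiffAt (ψ.open_source.mem_nhds hx)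
    have hinv : (mfderiv 𝓘(ℝ, E) 𝓘(ℝ, E) ψ x).IsInvertible := ⟨hd.mfderiv hx, rfl⟩
    exact (ContMDiffWithinAt.mpullback_vectorField_preimage hYs hψx hinv le_rfl).mono
      fun y hy ↦ ψ.map_source hy
  · -- `Ψ^* (ψ^* Ỹ) = Y`
    have hB := isInvertible_mfderiv_inv hψ p
    have hA : (mfderiv 𝓘(ℝ, E) 𝓘(ℝ, E) ψ (inv ψ p)).IsInvertible :=
      ⟨hd.mfderiv (inv_mem_source p), rfl⟩
    rw [mpullback_apply, hB.inverse_apply_eq, mpullback_apply, hA.inverse_apply_eq,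
      mfderiv_chart_comp_inv_apply hψ p]
    show (Yt (ψ (ψ.symm p)) : E) = (Y p : E)
    rw [ψ.right_inv p.2]
    exact (hYt p).symm

/-! ### Down: Killing fields of `g` pull back to Killing fields of `Ψ^* g` -/

variable (g : PseudoRiemannianMetric 𝓘(ℝ, E) ∞ E (TangentSpace 𝓘(ℝ, E) : X → Type _))

/-- **A local Killing field read in the chart.** If `L` is a Killing field of `g` on the open set
`D ⊆ X` (`C^∞` on `D`, Killing equation at the points of `D`), then `Ψ^* L` is a Killing field of
`Ψ^* g` on `Ψ ⁻¹' D`. O'Neill 1983, Ch. 9, Prop. 9.25 with Ch. 3, Prop. 3.59 (the tree's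
`IsKillingFieldOn.comap_mpullback` for `Φ = Ψ`). [cite: ONeill1983, Ch. 9, Prop. 9.25] -/
theorem isKillingFieldOn_mpullback_inv [CompleteSpace E] [g.HasLeviCivita]
    (hψ : ψ ∈ IsManifold.maximalAtlas 𝓘(ℝ, E) ∞ X) [(metric g hψ).HasLeviCivita]
    {L : Π x : X, TangentSpace 𝓘(ℝ, E) x} {D : Set X} (hD : IsOpen D)
    (hL : g.IsKillingFieldOn L D) :
    (metric g hψ).IsKillingFieldOn (mpullback 𝓘(ℝ, E) 𝓘(ℝ, E) (inv ψ) L) (inv ψ ⁻¹' D) :=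
  PseudoRiemannianMetric.IsKillingFieldOn.comap_mpullback g
    PseudoRiemannianMetric.contMDiff_pullbackBilin_holds (contMDiff_inv hψ)
    (injective_mfderiv_inv hψ) rfl hD hL

/-- **A global Killing field read in the chart**: `Ψ^* T` is a Killing field of `Ψ^* g` on the
whole chart target. O'Neill 1983, Ch. 9, Prop. 9.25 (the tree's `IsKillingField.comap_mpullback`).
[cite: ONeill1983, Ch. 9, Prop. 9.25] -/
theorem isKillingField_mpullback_inv [CompleteSpace E] [g.HasLeviCivita]
    (hψ : ψ ∈ IsManifold.maximalAtlas 𝓘(ℝ, E) ∞ X) [(metric g hψ).HasLeviCivita]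
    {T : Π x : X, TangentSpace 𝓘(ℝ, E) x} (hT : g.IsKillingField T) :
    (metric g hψ).IsKillingField (mpullback 𝓘(ℝ, E) 𝓘(ℝ, E) (inv ψ) T) :=
  PseudoRiemannianMetric.IsKillingField.comap_mpullback g
    PseudoRiemannianMetric.contMDiff_pullbackBilin_holds (contMDiff_inv hψ)
    (injective_mfderiv_inv hψ) rfl hT

/-! ### Up: the Killing equation and brackets -/

/-- **The Killing equation transported back to `X`.** Let `L'` be a section of `TX`, `C^∞` on
`ψ.source`, whose pullback `Ψ^* L'` satisfies the Killing equation of `Ψ^* g` at every point of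
the chart target. Then `L'` satisfies the Killing equation of `g` at every point of `ψ.source`:
by naturality (`val_leviCivita_mpullback_add`)
`(Ψ^*g)(∇_{Y₀} Ψ^*L', Z₀) + (Ψ^*g)(Y₀, ∇_{Z₀} Ψ^*L') = g(∇_{dΨ Y₀} L', dΨ Z₀) + g(dΨ Y₀, ∇_{dΨ Z₀} L')`
and `dΨ_p` is onto. O'Neill 1983, Ch. 9, Prop. 9.25 with Ch. 3, Prop. 3.59.
[cite: ONeill1983, Ch. 9, Prop. 9.25] -/
theorem killingOn_source_of_mpullback_inv [CompleteSpace E] [g.HasLeviCivita]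
    (hψ : ψ ∈ IsManifold.maximalAtlas 𝓘(ℝ, E) ∞ X) [(metric g hψ).HasLeviCivita]
    {L' : Π x : X, TangentSpace 𝓘(ℝ, E) x}
    (hL's : ContMDiffOn 𝓘(ℝ, E) (𝓘(ℝ, E).prod 𝓘(ℝ, E)) ∞
      (fun x ↦ (TotalSpace.mk' E x (L' x) : TangentBundle 𝓘(ℝ, E) X)) ψ.source)
    (hK : ∀ (p : target ψ) (Y₀ Z₀ : TangentSpace 𝓘(ℝ, E) p),
      (metric g hψ).val p
          ((metric g hψ).leviCivita (mpullback 𝓘(ℝ, E) 𝓘(ℝ, E) (inv ψ) L') p Y₀) Z₀ +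
        (metric g hψ).val p Y₀
          ((metric g hψ).leviCivita (mpullback 𝓘(ℝ, E) 𝓘(ℝ, E) (inv ψ) L') p Z₀) = 0) :
    ∀ x ∈ ψ.source, ∀ v w : TangentSpace 𝓘(ℝ, E) x,
      g.val x (g.leviCivita L' x v) w + g.val x v (g.leviCivita L' x w) = 0 := by
  intro x hx
  obtain ⟨p, rfl⟩ := exists_inv_eq hx
  intro v w
  have hXd : MDiffAt (T% L') (inv ψ p) :=
    ((hL's _ hx).contMDiffAt (ψ.open_source.mem_nhds hx)).mdifferentiableAt (by simp)
  have hB := isInvertible_mfderiv_inv hψ p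
  have h := g.val_leviCivita_mpullback_add PseudoRiemannianMetric.contMDiff_pullbackBilin_holds
    (contMDiff_inv hψ) (injective_mfderiv_inv hψ) rfl hXd ((mfderiv 𝓘(ℝ, E) 𝓘(ℝ, E) (inv ψ) p).inverse v)
    ((mfderiv 𝓘(ℝ, E) 𝓘(ℝ, E) (inv ψ) p).inverse w)
  rw [hB.self_apply_inverse, hB.self_apply_inverse] at h
  rw [← h]
  exact hK p _ _

/-- **Brackets transported back to `X`**: for sections `T`, `L'` of `TX` differentiable at `Ψ p`,
`[T, L'](Ψ p) = dΨ_p ([Ψ^* T, Ψ^* L'] p)` (the pullback along the local diffeomorphism `Ψ`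
commutes with brackets, Mathlib's `VectorField.mpullback_mlieBracket`, and `dΨ_p (Ψ^* V)(p) = V (Ψ p)`).
O'Neill 1983, Ch. 1, Lemma 1.21 ff. (`dφ[V, W] = [dφ V, dφ W]` for `φ`-related fields). [folklore] -/
theorem mlieBracket_inv_eq [CompleteSpace E] (hψ : ψ ∈ IsManifold.maximalAtlas 𝓘(ℝ, E) ∞ X)
    {T L' : Π x : X, TangentSpace 𝓘(ℝ, E) x} (p : target ψ)
    (hT : MDiffAt (T% T) (inv ψ p)) (hL' : MDiffAt (T% L') (inv ψ p)) :
    mlieBracket 𝓘(ℝ, E) T L' (inv ψ p) =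
      mfderiv 𝓘(ℝ, E) 𝓘(ℝ, E) (inv ψ) p
        (mlieBracket 𝓘(ℝ, E) (mpullback 𝓘(ℝ, E) 𝓘(ℝ, E) (inv ψ) T)
          (mpullback 𝓘(ℝ, E) 𝓘(ℝ, E) (inv ψ) L') p) := by
  haveI : IsManifold 𝓘(ℝ, E) (minSmoothness ℝ 2) X := by
    rw [minSmoothness_of_isRCLikeNormedField]; infer_instance
  have hn : minSmoothness ℝ 2 ≤ (∞ : ℕ∞ω) := by
    rw [minSmoothness_of_isRCLikeNormedField]; exact ENat.LEInfty.out
  have h := mpullback_mlieBracket (I := 𝓘(ℝ, E)) (I' := 𝓘(ℝ, E)) hT hL'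
    ((contMDiff_inv' hψ) p) hn
  rw [← h]
  exact apply_inv_eq_mfderiv_mpullback hψ _ p

omit [IsManifold 𝓘(ℝ, E) ∞ X] in
/-- **`Ψ`-related fields agree where their pullbacks do**: if `Ψ^* L' = Ψ^* L` at `p` then
`L' (Ψ p) = L (Ψ p)`. [folklore] -/
theorem apply_inv_eq_of_mpullback_eq (hψ : ψ ∈ IsManifold.maximalAtlas 𝓘(ℝ, E) ∞ X)
    {L L' : Π x : X, TangentSpace 𝓘(ℝ, E) x} {p : target ψ}
    (h : mpullback 𝓘(ℝ, E) 𝓘(ℝ, E) (inv ψ) L' p = mpullback 𝓘(ℝ, E) 𝓘(ℝ, E) (inv ψ) L p) :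
    L' (inv ψ p) = L (inv ψ p) := by
  rw [apply_inv_eq_mfderiv_mpullback hψ L' p, apply_inv_eq_mfderiv_mpullback hψ L p, h]

end MaxAtlasChart

end Literature.Geometry.Lorentzian

end
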